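import Summits.AnomalousDissipation.AnomalousDissipation.Statement
import Literature.Analysis.FluidPDE.LerayHopfGalileanTorus
import Literature.Analysis.FluidPDE.LerayHopfGalileanTorusMeans
import Literature.Analysis.FluidPDE.LerayHopfGalileanTorusEnergy
import Literature.Analysis.FluidPDE.LerayHopfDatumTorus
import Literature.Analysis.FluidPDE.LongTimeAverageNonneg

/-!
# Solo (blind) — the momentum leaf of `ZerothLaw`: Galilean reduction to zero momentum

`Literature.Turb.ZerothLaw` fixes ONE steady force `f` (smooth, divergence free, mean zero) and asks
for global Leray–Hopf solutions `u_j` of `NS_{ν_j}(f)`, `ν_j → 0⁺`, with `⟨‖u_j‖₂²⟩ ≤ E` and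
`⟨ν_j‖∇u_j‖₂²⟩ ≥ ε > 0`; the initial data, and with them the TOTAL MOMENTUM, are free. Since the
force has zero mean, the momentum `P_j = ∫ u_j(t)` is conserved (`t > 0`,
`Torus.IsLerayHopfOn.inner_integral_eq_of_steady`), and by Jensen on the unit torus
`‖P_j‖² ≤ ∫‖u_j(t)‖²` for every `t > 0`, whence `‖P_j‖² ≤ ⟨‖u_j‖₂²⟩ ≤ E`
(`norm_sq_momentum_le_meanEnergy`). Passing to the frame moving with `P_j` (Galilean covariance
of Leray–Hopf solutions on the torus, `Torus.IsGlobalLerayHopf.galilean_unboost_update`) turns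
`u_j` into a ZERO-MOMENTUM Leray–Hopf solution driven by the uniformly translating force
`(t, y) ↦ f (y + [t P_j])`, with the same mean dissipation and mean energy `≤ 2⟨‖u_j‖₂²⟩ + 2‖P_j‖² ≤ 4E`.

Hence the statement is sandwiched between two zero-momentum laws,

  `ZerothLaw₀ → ZerothLaw → TranslatingZerothLaw₀`,

where `ZerothLaw₀` is the zeroth law at zero momentum for the steady force and
`TranslatingZerothLaw₀` the zeroth law at zero momentum for forces swept at constant velocities
`c_j` with `‖c_j‖² ≤ E` (`zerothLaw_of_zerothLaw₀`, `translatingZerothLaw₀_of_zerothLaw`). The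
only freedom the free data add to the zero-momentum problem is thus a bounded uniform sweeping of
the force pattern.

The datum of the accepted Leray–Hopf notion is an arbitrary function seen through Bochner
pairings; the dichotomy `Torus.IsLerayHopfOn.aestronglyMeasurable_datum_or` (either `u₀ ∈ L²`, or
the datum functional vanishes on `L²`, in which case the momentum is zero and no change of frame is
needed) makes the reduction unconditional (`exists_galilean_zeroMomentum`).

* `norm_sq_momentum_le_meanEnergy` — `‖∫ u(t)‖² ≤ ⟨‖u‖₂²⟩` for `t > 0` (`ν > 0`).
* `exists_galilean_zeroMomentum` — the zero-momentum co-moving representative of one solution.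
* `ZerothLaw₀`, `TranslatingZerothLaw₀` and the two implications.

[cite: Frisch1995, §2.2 (Galilean invariance of Navier–Stokes on the periodic box)]
[cite: DoeringFoias2002, §2 (a priori bounds on the long-time means)] [folklore]
-/

open MeasureTheory Filter Topology Set Function
open scoped ENNReal NNReal RealInnerProductSpace InnerProductSpace

noncomputable section

namespace Summit.AnomalousDissipation.AnomalousDissipation.Theorems

open Literature.Analysis.FunctionSpaces Literature.Analysis.FunctionSpaces.Torus
open Literature.Analysis.FluidPDE

/-! ### The mean energy is nonnegative -/

/-- The mean energy is nonnegative. [folklore] -/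
theorem meanEnergy_nonneg {d : Type*} [Fintype d] (u : ℝ → UnitAddTorus d → EuclideanSpace ℝ d) :
    0 ≤ meanEnergy u := by
  rw [meanEnergy_eq_longTimeAvgSup]
  exact longTimeAvgSup_nonneg fun t => integral_nonneg fun _ => sq_nonneg _

/-! ### Momentum of a Leray–Hopf solution driven by a steady mean-zero force -/

section Momentum

variable {ν : ℝ} {f u₀ : UnitAddTorus (Fin 3) → EuclideanSpace ℝ (Fin 3)}
  {u : ℝ → UnitAddTorus (Fin 3) → EuclideanSpace ℝ (Fin 3)}

/-- **Momentum dichotomy.** Along a global Leray–Hopf solution driven by a steady smooth mean-zero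
force, either the datum is in `L²` and the momentum `∫ u(t)` equals `∫ u₀` for every `t > 0`, or
the datum functional vanishes on `L²` and then `∫ u₀ = 0` and `∫ u(t) = 0` for every `t > 0`.
[folklore] -/
theorem momentum_dichotomy (hu : Torus.IsGlobalLerayHopf ν (fun _ => f) u₀ u) (hf : IsSmooth f)
    (hf0 : HasZeroMean f) :
    (MemLp u₀ 2 volume ∧ ∀ t, 0 < t → ∫ y, u t y = ∫ y, u₀ y) ∨
      (HasZeroMean u₀ ∧ ∀ t, 0 < t → ∫ y, u t y = 0) := by
  have hmom : ∀ t, 0 < t → ∀ V : EuclideanSpace ℝ (Fin 3), ⟪∫ y, u t y, V⟫ = ∫ y, ⟪u₀ y, V⟫ :=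
    fun t ht V => (hu t ht).inner_integral_eq_of_steady ht hf hf0 V ⟨ht, le_rfl⟩
  rcases (hu 1 one_pos).aestronglyMeasurable_datum_or one_pos with hmeas | hdeg
  · have hL2 : MemLp u₀ 2 volume := hu.memLp_two_datum hmeas
    have hint : Integrable u₀ volume := hL2.integrable one_le_two
    refine Or.inl ⟨hL2, fun t ht => ext_inner_right ℝ fun V => ?_⟩
    rw [hmom t ht V, Torus.inner_integral_left_eq_integral_inner hint V]
  · have hslice : ∀ t, 0 < t → ∫ y, u t y = 0 := by
      intro t ht
      refine ext_inner_right ℝ fun V => ?_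
      rw [hmom t ht V, hdeg (fun _ => V) (memLp_const V), inner_zero_left]
    refine Or.inr ⟨?_, hslice⟩
    show ∫ y, u₀ y = 0
    by_cases hint : Integrable u₀ volume
    · refine ext_inner_right ℝ fun V => ?_
      rw [Torus.inner_integral_left_eq_integral_inner hint V, hdeg (fun _ => V) (memLp_const V),
        inner_zero_left]
    · exact integral_undef hint

/-- The running energy means of a global Leray–Hopf solution driven by a steady smooth mean-zero
force at `ν > 0` are eventually bounded (Doering–Foias). [cite: DoeringFoias2002, §2] -/
private theorem timeMean_energy_bddAbove (hν : 0 < ν) (hu : Torus.IsGlobalLerayHopf ν (fun _ => f) u₀ u)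
    (hf : IsSmooth f) (hf0 : HasZeroMean f) :
    IsBoundedUnder (· ≤ ·) atTop (timeMean fun t => ∫ x, ‖u t x‖ ^ 2) := by
  refine ⟨kineticEnergy u₀ / (2 * Real.pi ^ 2 * ν) +
    (2 * ‖∫ x, u 1 x‖ ^ 2 + (∫ x, ‖f x‖ ^ 2) / (16 * Real.pi ^ 4 * ν ^ 2)), ?_⟩
  rw [eventually_map]
  filter_upwards [eventually_ge_atTop (1 : ℝ)] with T hT
  exact hu.timeMean_norm_sq_le hν hf hf0 hT

/-- **The momentum is controlled by the mean energy**: `‖∫ u(t)‖² ≤ ⟨‖u‖₂²⟩` for every `t > 0`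
along a global Leray–Hopf solution driven by a steady smooth mean-zero force at `ν > 0`
(conservation of momentum, and `‖∫ w‖² ≤ ∫‖w‖²` on the unit torus slice by slice). [folklore] -/
theorem norm_sq_momentum_le_meanEnergy (hν : 0 < ν) (hu : Torus.IsGlobalLerayHopf ν (fun _ => f) u₀ u)
    (hf : IsSmooth f) (hf0 : HasZeroMean f) {t : ℝ} (ht : 0 < t) :
    ‖∫ y, u t y‖ ^ 2 ≤ meanEnergy u := by
  set m : EuclideanSpace ℝ (Fin 3) := ∫ y, u t y with hm
  -- the momentum is the same at all positive times
  have hconst : ∀ s, 0 < s → ∫ y, u s y = m := by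
    rcases momentum_dichotomy hu hf hf0 with ⟨-, h⟩ | ⟨-, h⟩
    · intro s hs; rw [hm, h s hs, h t ht]
    · intro s hs; rw [hm, h s hs, h t ht]
  -- slice by slice `‖m‖² ≤ ∫‖u s‖²`
  have hpt : ∀ s, 0 < s → ‖m‖ ^ 2 ≤ ∫ y, ‖u s y‖ ^ 2 := by
    intro s hs
    have hus : MemLp (u s) 2 volume := (hu s hs).memLp s ⟨hs.le, le_rfl⟩
    have h := Torus.integral_norm_sq_comp_add_right_sub_const hus 0 m
    rw [hconst s hs, real_inner_self_eq_norm_sq] at h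
    have h0 : 0 ≤ ∫ y, ‖u s (y + 0) - m‖ ^ 2 := integral_nonneg fun _ => sq_nonneg _
    linarith
  rw [meanEnergy_eq_longTimeAvgSup]
  have h1 := longTimeAvgSup_mono (u := fun _ => ‖m‖ ^ 2) (g := fun s => ∫ y, ‖u s y‖ ^ 2)
    (fun _ => sq_nonneg _) (fun _ => integral_nonneg fun _ => sq_nonneg _)
    (fun T hT => hu.integrableOn_integral_norm_sq hT) hpt (timeMean_energy_bddAbove hν hu hf hf0)
  -- the long-time average of the constant `‖m‖²` is `‖m‖²`
  have hK : longTimeAvgSup (fun _ : ℝ => ‖m‖ ^ 2) = ‖m‖ ^ 2 := by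
    have hmean : ∀ T, 0 < T → timeMean (fun _ => ‖m‖ ^ 2) T = ‖m‖ ^ 2 := fun T hT => by
      unfold timeMean
      rw [intervalIntegral.integral_const, smul_eq_mul, sub_zero, ← mul_assoc,
        inv_mul_cancel₀ hT.ne', one_mul]
    unfold longTimeAvgSup
    rw [limsup_congr ((eventually_gt_atTop (0 : ℝ)).mono fun T hT => hmean T hT)]
    exact limsup_const _
  rwa [hK] at h1

/-- **Zero-momentum co-moving representative.** For every global Leray–Hopf solution `u` of
`NS_ν(f)` (`ν > 0`, `f` steady smooth mean zero) there are a constant velocity `c` with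
`‖c‖² ≤ ⟨‖u‖₂²⟩` and a global Leray–Hopf solution `v` driven by the uniformly translating force
`(t, y) ↦ f (y + [t c])`, with mean-zero datum and ZERO MOMENTUM at all positive times, the same mean
dissipation, and mean energy `≤ 4⟨‖u‖₂²⟩` (`v(t) = u(t, · + [t c]) − c`, `c = ∫ u(t)`).
[cite: Frisch1995, §2.2] -/
theorem exists_galilean_zeroMomentum (hν : 0 < ν) (hu : Torus.IsGlobalLerayHopf ν (fun _ => f) u₀ u)
    (hf : IsSmooth f) (hf0 : HasZeroMean f) :
    ∃ (c : EuclideanSpace ℝ (Fin 3)) (v₀ : UnitAddTorus (Fin 3) → EuclideanSpace ℝ (Fin 3))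
      (v : ℝ → UnitAddTorus (Fin 3) → EuclideanSpace ℝ (Fin 3)),
      ‖c‖ ^ 2 ≤ meanEnergy u ∧
        Torus.IsGlobalLerayHopf ν (fun t y => f (y + proj (t • c))) v₀ v ∧
        HasZeroMean v₀ ∧ (∀ t, 0 < t → ∫ y, v t y = 0) ∧
        meanEnergy v ≤ 4 * meanEnergy u ∧ meanDissipation ν v = meanDissipation ν u := by
  rcases momentum_dichotomy hu hf hf0 with ⟨hL2, hmom⟩ | ⟨hdat, hmom⟩
  · -- honest `L²` datum: boost by the conserved momentum `m = ∫ u₀`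
    have hint : Integrable u₀ volume := hL2.integrable one_le_two
    set m : EuclideanSpace ℝ (Fin 3) := ∫ y, u₀ y with hm
    have hcE : ‖m‖ ^ 2 ≤ meanEnergy u := by
      rw [← hmom 1 one_pos]; exact norm_sq_momentum_le_meanEnergy hν hu hf hf0 one_pos
    have hB := hu.galilean_unboost_update hf hf0 hL2 m
    set v : ℝ → UnitAddTorus (Fin 3) → EuclideanSpace ℝ (Fin 3) :=
      fun t y => update u 0 u₀ t (y + proj (t • m)) - m with hv
    have hveq : ∀ t, 0 < t → v t = (fun t y => u t (y + proj (t • m)) - m) t := by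
      intro t ht
      funext y
      simp only [hv, update_of_ne ht.ne']
    refine ⟨m, fun y => u₀ y - m, v, hcE, hB, ?_, ?_, ?_, ?_⟩
    · show ∫ y, (u₀ y - m) = 0
      rw [integral_sub hint (integrable_const m), integral_const]
      simp [Measure.real, hm]
    · intro t ht
      rw [hveq t ht]
      have huti : Integrable (u t) volume := ((hu t ht).memLp t ⟨ht.le, le_rfl⟩).integrable one_le_two
      show ∫ y, (u t (y + proj (t • m)) - m) = 0
      rw [integral_sub (huti.comp_add_right _) (integrable_const m), integral_const,
        integral_add_right_eq_self (u t) (proj (t • m)), hmom t ht]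
      simp [Measure.real]
    · rw [meanEnergy_congr_of_eqOn_Ioi hveq]
      have := hu.meanEnergy_galilean_le hν hf hf0 m
      linarith
    · rw [meanDissipation_congr_of_eqOn_Ioi hveq]
      exact hu.meanDissipation_galilean m
  · -- degenerate datum: the momentum vanishes, no change of frame
    refine ⟨0, u₀, u, ?_, ?_, hdat, hmom, ?_, rfl⟩
    · rw [norm_zero, sq, mul_zero]; exact meanEnergy_nonneg u
    · have hF : (fun (t : ℝ) (y : UnitAddTorus (Fin 3)) => f (y + proj (t • (0 : EuclideanSpace ℝ (Fin 3))))) =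
          fun _ => f := by
        funext t y
        rw [smul_zero, proj_zero, add_zero]
      rw [hF]
      exact hu
    · linarith [meanEnergy_nonneg u]

end Momentum

/-! ### The two zero-momentum laws and the sandwich -/

/-- OPEN CONJECTURE — **the zeroth law at zero momentum (steady force)** (registered open statement,
stated here): `Literature.Turb.ZerothLaw` with the witnesses restricted to zero momentum — mean-zero
data and `∫ u_j(t) = 0` for all `t > 0`. It implies the summit (`zerothLaw_of_zerothLaw₀`); users keep
the explicit hypothesis `(h : ZerothLaw₀)`.
[cite: BrueDeLellis2023, §2 Questions 2.1–2.2 (zero-momentum sharpening, posed here)] -/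
@[conjecture] def ZerothLaw₀ : Prop :=
  ∃ f : UnitAddTorus (Fin 3) → EuclideanSpace ℝ (Fin 3), IsSmooth f ∧ IsDivFree f ∧ HasZeroMean f ∧
    ∃ (ν : ℕ → ℝ) (u₀ : ℕ → UnitAddTorus (Fin 3) → EuclideanSpace ℝ (Fin 3))
      (u : ℕ → ℝ → UnitAddTorus (Fin 3) → EuclideanSpace ℝ (Fin 3)),
      (∀ j, 0 < ν j) ∧ Tendsto ν atTop (𝓝 0) ∧
        (∀ j, Torus.IsGlobalLerayHopf (ν j) (fun _ => f) (u₀ j) (u j)) ∧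
        (∀ j, HasZeroMean (u₀ j)) ∧ (∀ j t, 0 < t → ∫ y, u j t y = 0) ∧
        (∃ E : ℝ, ∀ j, meanEnergy (u j) ≤ E) ∧
        ∃ ε : ℝ, 0 < ε ∧ ∀ j, ε ≤ meanDissipation (ν j) (u j)

/-- OPEN CONJECTURE — **the zeroth law at zero momentum for uniformly translating forces**
(registered open statement, stated here): one pattern `f` swept at constant velocities `c_j`,
`‖c_j‖² ≤ E`; zero-momentum global Leray–Hopf solutions of `NS_{ν_j}` with force
`(t, y) ↦ f (y + [t c_j])`, `ν_j → 0⁺`, mean energy `≤ E` and mean dissipation `≥ ε > 0`. It is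
implied by the summit (`translatingZerothLaw₀_of_zerothLaw`); users keep the explicit hypothesis.
[cite: BrueDeLellis2023, §2 Questions 2.1–2.2 (swept-force weakening, posed here)] -/
@[conjecture] def TranslatingZerothLaw₀ : Prop :=
  ∃ f : UnitAddTorus (Fin 3) → EuclideanSpace ℝ (Fin 3), IsSmooth f ∧ IsDivFree f ∧ HasZeroMean f ∧
    ∃ (ν : ℕ → ℝ) (c : ℕ → EuclideanSpace ℝ (Fin 3))
      (u₀ : ℕ → UnitAddTorus (Fin 3) → EuclideanSpace ℝ (Fin 3))
      (u : ℕ → ℝ → UnitAddTorus (Fin 3) → EuclideanSpace ℝ (Fin 3)),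
      (∀ j, 0 < ν j) ∧ Tendsto ν atTop (𝓝 0) ∧
        (∀ j, Torus.IsGlobalLerayHopf (ν j) (fun t y => f (y + proj (t • c j))) (u₀ j) (u j)) ∧
        (∀ j, HasZeroMean (u₀ j)) ∧ (∀ j t, 0 < t → ∫ y, u j t y = 0) ∧
        (∃ E : ℝ, ∀ j, ‖c j‖ ^ 2 ≤ E ∧ meanEnergy (u j) ≤ E) ∧
        ∃ ε : ℝ, 0 < ε ∧ ∀ j, ε ≤ meanDissipation (ν j) (u j)

/-- `ZerothLaw₀ → ZerothLaw` (forget the momentum constraint). [folklore] -/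
theorem zerothLaw_of_zerothLaw₀ (h : ZerothLaw₀) : Literature.Turb.ZerothLaw := by
  obtain ⟨f, hf, hdiv, hf0, ν, u₀, u, hν, hν0, hLH, -, -, hE, hε⟩ := h
  exact ⟨f, hf, hdiv, hf0, ν, u₀, u, hν, hν0, hLH, hE, hε⟩

/-- **`ZerothLaw → TranslatingZerothLaw₀`**: boosting each witness to its zero-momentum frame costs a
bounded sweeping velocity (`‖c_j‖² ≤ E`) and a factor `4` in the energy bound, and leaves the
dissipation floor untouched. [cite: Frisch1995, §2.2] -/
theorem translatingZerothLaw₀_of_zerothLaw (h : Literature.Turb.ZerothLaw) : TranslatingZerothLaw₀ := by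
  obtain ⟨f, hf, hdiv, hf0, ν, u₀, u, hν, hν0, hLH, ⟨E, hE⟩, ε, hε, hεle⟩ := h
  have hw := fun j => exists_galilean_zeroMomentum (hν j) (hLH j) hf hf0
  choose c v₀ v hc hB hz₀ hz hEv hDv using hw
  have hE0 : 0 ≤ E := (sq_nonneg _).trans ((hc 0).trans (hE 0))
  refine ⟨f, hf, hdiv, hf0, ν, c, v₀, v, hν, hν0, hB, hz₀, hz, ⟨4 * E, fun j => ⟨?_, ?_⟩⟩, ε, hε,
    fun j => ?_⟩
  · linarith [hc j, hE j]
  · linarith [hEv j, hE j]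
  · rw [hDv j]; exact hεle j

/-- The sandwich, lower half composed: `ZerothLaw₀ → TranslatingZerothLaw₀`. [folklore] -/
theorem translatingZerothLaw₀_of_zerothLaw₀ (h : ZerothLaw₀) : TranslatingZerothLaw₀ :=
  translatingZerothLaw₀_of_zerothLaw (zerothLaw_of_zerothLaw₀ h)

end Summit.AnomalousDissipation.AnomalousDissipation.Theorems

end
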